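import Mathlib.NumberTheory.NumberField.Basic
import Literature.NumberTheory.EllipticCurves.PAdicHeights
import HarnessLib

/-!
# `p`-adic height data over a number field `K` (hypothesis structure)

Trunk T-ELLARITH (Literature/NumberTheory/EllipticCurves); definition request
`defn-PAdicHeightDataK` (route BirchSwinnertonDyer/PAdicOrder; consumer: the `p`-adic Gross–Zagier
fact `wi-03670`, height of the Heegner point `P_K ∈ E(K)`).

Exactly parallel to `WeierstrassCurve.PAdicHeightData W p` (`PAdicHeights.lean`, pairing on
`E(ℚ) = W.toAffine.Point`): for `E/ℚ` given by `W`, a prime `p` and a number field `K` (in the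
application: imaginary quadratic), `PAdicHeightDataK W p K` is a symmetric bilinear pairing on
`E(K) = (W.baseChange K).toAffine.Point` with values in `ℚ_p`, vanishing on torsion. Intended
instance: the canonical cyclotomic `p`-adic height over `K` at a good ordinary `p`
(Schneider 1982; Mazur–Tate–Teitelbaum 1986, §II.4–5; Perrin-Riou 1987, §1.2; Nekovář 2006, §11);
as for the `ℚ`-version the NORMALISATION IS NOT AXIOMATISED (the zero pairing is an instance:
statements quantify over the datum; canonicity predicate to follow `defn-IsCanonicalPAdicHeight`).

Compatibility with a `ℚ`-datum `D` under `E(ℚ) ↪ E(K)` (`pointToBaseChange`) is a separate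
predicate `RestrictsTo DK D`, stated in the UN-normalised convention `h_{p,K}|_{E(ℚ)} = [K:ℚ] · h_{p,ℚ}`
(heights over `K` are sums over the places of `K`, so a rational point acquires the factor
`[K:ℚ]`, `= 2` for `K` imaginary quadratic; Mazur–Tate–Teitelbaum 1986, §II.5; Perrin-Riou 1987,
§1.2). Authors normalising by `1/[K:ℚ]` get factor `1`: use `RestrictsToWith DK D 1`.

## Sources

* P. Schneider, *p-adic height pairings I*, Invent. Math. 69 (1982), §1.
* B. Mazur, J. Tate, J. Teitelbaum, *On p-adic analogues of the conjectures of Birch and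
  Swinnerton-Dyer*, Invent. Math. 84 (1986), §II.4–II.5.
* B. Perrin-Riou, *Points de Heegner et dérivées de fonctions L p-adiques*, Invent. Math. 89
  (1987), §1.2.
* J. Nekovář, *Selmer complexes*, Astérisque 310 (2006), §11.
-/

noncomputable section

open scoped Classical

namespace WeierstrassCurve

variable (W : WeierstrassCurve ℚ) (p : ℕ) [Fact p.Prime] (K : Type) [Field K] [NumberField K]

/-- The inclusion `E(ℚ) ↪ E(K)` on points, `(x, y) ↦ (x, y)` (Mathlib `map_nonsingular` transports
non-singularity along the injective `algebraMap ℚ K`; `W.baseChange K = W.map (algebraMap ℚ K)`).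
A plain function (additivity is Mathlib's `Affine.Point.map`, stated over `W⁄ℚ`; not needed
here). [Silverman AEC, III.2] [folklore] -/
def pointToBaseChange : W.toAffine.Point → (W.baseChange K).toAffine.Point
  | .zero => .zero
  | .some x y h => .some (algebraMap ℚ K x) (algebraMap ℚ K y)
      ((Affine.map_nonsingular (W := W.toAffine) (algebraMap ℚ K).injective x y).2 h)

/-- **Hypothesis structure** for a `p`-adic height pairing on `E(K)`, `K` a number field: a
symmetric bilinear pairing `E(K) →+ E(K) →+ ℚ_p` vanishing on torsion (first variable; second by
symmetry). Parallel to `PAdicHeightData W p` (the case `K = ℚ` up to the identification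
`E(ℚ) = W.toAffine.Point`). Normalisation not axiomatised (zero pairing is an instance).
[Schneider 1982, §1; Mazur–Tate–Teitelbaum 1986, §II.4; Perrin-Riou 1987, §1.2; Nekovář 2006, §11] [cite: PerrinRiou1987, §1.2] -/
structure PAdicHeightDataK where
  /-- The bilinear pairing `E(K) →+ E(K) →+ ℚ_p`. -/
  pairing : (W.baseChange K).toAffine.Point →+ (W.baseChange K).toAffine.Point →+ ℚ_[p]
  /-- Symmetry. -/
  symm : ∀ P Q, pairing P Q = pairing Q P
  /-- Vanishing on torsion (first variable). -/
  map_torsion : ∀ P Q, IsOfFinAddOrder P → pairing P Q = 0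

namespace PAdicHeightDataK

variable {W p K}
variable (DK : PAdicHeightDataK W p K)

/-- Vanishing on torsion in the second variable. [folklore] -/
theorem map_torsion_right (P Q : (W.baseChange K).toAffine.Point) (hQ : IsOfFinAddOrder Q) :
    DK.pairing P Q = 0 := by
  rw [DK.symm]; exact DK.map_torsion Q P hQ

/-- The associated `p`-adic height `h_{p,K}(P) = ⟨P, P⟩`. [Mazur–Tate–Teitelbaum 1986, §II.4] [folklore] -/
def height (P : (W.baseChange K).toAffine.Point) : ℚ_[p] :=
  DK.pairing P P

/-- Polarisation: `⟨P, Q⟩ = (h(P+Q) - h(P) - h(Q))/2`, i.e. `2⟨P,Q⟩ = h(P+Q) - h(P) - h(Q)`.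
[Mazur–Tate–Teitelbaum 1986, §II.4] [folklore] -/
theorem two_mul_pairing (P Q : (W.baseChange K).toAffine.Point) :
    2 * DK.pairing P Q = DK.height (P + Q) - DK.height P - DK.height Q := by
  simp only [height, map_add, AddMonoidHom.add_apply, DK.symm Q P]
  ring

/-- **Compatibility with a `ℚ`-datum with factor `c`**: `⟨ιP, ιQ⟩_K = c · ⟨P, Q⟩_ℚ` for all
`P, Q ∈ E(ℚ)`, `ι = pointToBaseChange`. [Mazur–Tate–Teitelbaum 1986, §II.5; Perrin-Riou 1987, §1.2] [folklore] -/
def RestrictsToWith (D : PAdicHeightData W p) (c : ℕ) : Prop :=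
  ∀ P Q : W.toAffine.Point,
    DK.pairing (W.pointToBaseChange K P) (W.pointToBaseChange K Q) = (c : ℚ_[p]) * D.pairing P Q

/-- **Compatibility with a `ℚ`-datum, un-normalised convention**: restriction to `E(ℚ)` multiplies
by the degree `[K : ℚ]` (`= 2` for imaginary quadratic `K`), as for heights defined by sums over
the places of `K`. [Mazur–Tate–Teitelbaum 1986, §II.5; Perrin-Riou 1987, §1.2] [cite: PerrinRiou1987, §1.2] -/
def RestrictsTo (D : PAdicHeightData W p) : Prop :=
  DK.RestrictsToWith D (Module.finrank ℚ K)

/-- The zero datum (witnessing the vacuity risk flagged in the docstring: statements must quantify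
over the datum or use a canonicity predicate). [folklore] -/
def zero : PAdicHeightDataK W p K where
  pairing := 0
  symm := fun _ _ => rfl
  map_torsion := fun _ _ _ => rfl

/-- The zero `K`-datum restricts to the zero `ℚ`-pairing values with any factor. [folklore] -/
theorem zero_restrictsToWith (D : PAdicHeightData W p) (hD : ∀ P Q, D.pairing P Q = 0) (c : ℕ) :
    (zero : PAdicHeightDataK W p K).RestrictsToWith D c := fun P Q => by
  simp [zero, hD P Q]

end PAdicHeightDataK

end WeierstrassCurve
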